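import Summits.HodgeConjecture.HodgeConjecture.Theses.LinearSystemTorelli
import Literature.AlgebraicGeometry.HodgeTheory.ComplexGysinCorrespondence
import Literature.AlgebraicGeometry.HodgeTheory.GysinKernelProofs

/-!
# Crux `TranscendentalOrSupported` (stmt-HodgeConjecture-10853), line `Sketch_chow_shadow` — stub
# `stub_corrDiagonal`: the diagonal class `δ_X = Δ_* 1` acts as the identity

Helper file for the line skeleton `Cruxes/TranscendentalOrSupported/Lines/Sketch_chow_shadow.lean`
(cohomological transcendental decomposition of the diagonal) of the crux `TranscendentalOrSupported`
of route `LinearSystemTorelli`, registered stub `stub_corrDiagonal`. Notation: `X` smooth projective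
of dimension `n`, `μ` an orientation family, `Δ = (𝟙, 𝟙) : X ⟶ X ⊗ X` the diagonal
(`CartesianMonoidalCategory.lift (𝟙 X) (𝟙 X)`), `f_* = complexGysin μ …` the Gysin morphisms of the
tree (`ComplexGysin`: `PD⁻¹ ∘ f(ℂ)_* ∘ PD` in degrees `≤ 2 dim`, `0` beyond), and
`γ^* = corrAction μ hX hX hab γ : Hᵏ(X(ℂ); ℂ) → Hᵏ(X(ℂ); ℂ)`, `γ^*(c) = pr_{1*}(pr_2^* c ∪ γ)`, the
tree's REAL action of a class `γ ∈ H^{2n}((X ⊗ X)(ℂ); ℂ)` as a self-correspondence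
(`ComplexGysinCorrespondence`, first factor receives).

CLAIM (`stub_corrDiagonal`). For `δ_X = Δ_* 1 ∈ H^{2n}((X ⊗ X)(ℂ); ℂ)`, the Gysin image of the unit
`1 ∈ H⁰(X(ℂ); ℂ)` under the diagonal, `δ_X^* = Id` on `Hᵏ(X(ℂ); ℂ)`, every `k`.

PROOF (Voisin I §11.3.3, "the sum `Σ_k Id_k` is equal to the cohomology class of the diagonal";
Voisin II, proof of Thm. 10.17: "the morphisms `[Δ_X]^*` are equal to the identity"). For
`c ∈ Hᵏ(X(ℂ))`:
`pr_{1*}(pr_2^* c ∪ Δ_* 1) = pr_{1*} Δ_* (Δ^* pr_2^* c ∪ 1)` (projection formula `complexGysin_cup`,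
right to left), `Δ^* pr_2^* c = (Δ ≫ pr_2)^* c = c` (`complexBetti.map_comp`, `lift_snd`,
`complexBetti.map_id`), `x ∪ 1 = x` (`cupProduct_one`), and
`pr_{1*} ∘ Δ_* = (Δ ≫ pr_1)_* = (𝟙 X)_* = Id` (`complexGysin_comp`, `lift_fst`, `complexGysin_id`).
The three Gysin identities hold granted Poincaré duality for `μ`, which every orientation family
has (`OrientationFamily.hasPoincareDuality`, Hatcher Thm. 3.30). This is literally the proof of
`GysinFormalism.corrAct_primeCycle_diagonal` with the hypothesis-structure Gysin maps `G.gysin`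
replaced by the constructed `complexGysin μ` and the cycle class `cl[Δ]` by `Δ_* 1`.

Pure tree theorems; no named fact is taken as a hypothesis and none is introduced.

References: C. Voisin, *Hodge Theory and Complex Algebraic Geometry I* (CUP 2002), §7.3.2, §11.3.3;
C. Voisin, *Hodge Theory and Complex Algebraic Geometry II* (CUP 2003), proof of Thm. 10.17 (10.7);
W. Fulton, *Young Tableaux* (CUP 1997), App. B §B.1 (2), (5), (6); A. Hatcher, *Algebraic Topology*
(CUP 2002), §3.2 p. 211, §3.3 Thm. 3.30.
-/

-- `Summit.HodgeConjecture.HodgeConjecture.Theorems` is the mandated namespace (single-conjunct summit: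
-- Sub = Summit), which `linter.dupNamespace` flags on every declaration; the lakefile turns the
-- linter off tree-wide (weak option), restated here so stand-alone elaboration is warning-free too.
set_option linter.dupNamespace false

noncomputable section

namespace Summit.HodgeConjecture.HodgeConjecture.Theorems

open CategoryTheory MonoidalCategory CartesianMonoidalCategory
open Literature.AlgebraicGeometry.Motives Literature.AlgebraicGeometry.HodgeTheory
open Literature.AlgebraicTopology.SingularHomology

/-! ### `pr_{1*} ∘ Δ_* = Id` -/

/-- **`pr_{1*}(Δ_* y) = y`** on `Hᵏ(X(ℂ); ℂ)`: `pr_{1*} ∘ Δ_* = (Δ ≫ pr_1)_* = (𝟙 X)_* = Id`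
(`complexGysin_comp`, `lift_fst`, `complexGysin_id`, granted Poincaré duality
`OrientationFamily.hasPoincareDuality μ`), for any proof terms of the two degree equations.
[cite: FultonYoungTableaux1997, Appendix B §B.1 (2) and (5)] -/
theorem complexGysin_fst_complexGysin_diagonal (μ : OrientationFamily) {n : ℕ} {X : SchemeOver ℂ}
    (hX : IsSmoothProjective n X) {k b : ℕ} (h₁ : k + 2 * (n + n) = b + 2 * n)
    (h₂ : b + 2 * n = k + 2 * (n + n)) (y : complexBetti X k) :
    complexGysin μ (IsSmoothProjective.tensor_holds hX hX) hX (fst X X) h₂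
      (complexGysin μ hX (IsSmoothProjective.tensor_holds hX hX) (lift (𝟙 X) (𝟙 X)) h₁ y) = y := by
  rw [← LinearMap.comp_apply, ← complexGysin_comp μ.hasPoincareDuality hX
    (IsSmoothProjective.tensor_holds hX hX) hX (lift (𝟙 X) (𝟙 X)) (fst X X) h₁ h₂]
  simp only [lift_fst]
  rw [complexGysin_id μ.hasPoincareDuality hX k, LinearMap.id_apply]

/-! ### The stub -/

/-- **STUB `stub_corrDiagonal` (`[Δ_X]^* = Id` for the REAL Gysin morphisms) of the crux
`TranscendentalOrSupported`, line `Sketch_chow_shadow`.** The Gysin image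
`δ_X = Δ_* 1 ∈ H^{2n}((X ⊗ X)(ℂ); ℂ)` of `1 ∈ H⁰(X(ℂ); ℂ)` under the diagonal
`Δ = (𝟙, 𝟙) : X ⟶ X ⊗ X` acts as the identity on `Hᵏ(X(ℂ); ℂ)` through
`corrAction μ hX hX hab γ c = pr_{1*}(pr_2^* c ∪ γ)`:
`pr_{1*}(pr_2^* c ∪ Δ_* 1) = pr_{1*} Δ_*(Δ^* pr_2^* c ∪ 1) = (Δ ≫ pr_1)_* ((Δ ≫ pr_2)^* c) = c` by the
projection formula `complexGysin_cup`, `complexBetti.map_comp` / `lift_snd` / `complexBetti.map_id`,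
`cupProduct_one`, and `complexGysin_comp` / `lift_fst` / `complexGysin_id` (Poincaré duality
`OrientationFamily.hasPoincareDuality μ`) — the proof of `GysinFormalism.corrAct_primeCycle_diagonal`
with `G.gysin` replaced by `complexGysin μ` and `cl[Δ]` by `Δ_* 1`.
[cite: VoisinHodgeI2002, §11.3.3] [cite: VoisinHodgeII2003, proof of Thm. 10.17 (10.7)]
[cite: FultonYoungTableaux1997, Appendix B §B.1 (5) and (6)] -/
theorem stub_corrDiagonal :
    ∀ (μ : OrientationFamily) ⦃n : ℕ⦄ ⦃X : SchemeOver ℂ⦄ (hX : IsSmoothProjective n X) (k : ℕ)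
    (hδ : 0 + 2 * (n + n) = 2 * n + 2 * n) (hab : k + 2 * n = k + 2 * n),
    corrAction μ hX hX hab
      (complexGysin μ hX (IsSmoothProjective.tensor_holds hX hX) (lift (𝟙 X) (𝟙 X)) hδ
        (singularCohomology.one ℂ (ComplexPoints X))) = LinearMap.id := by
  intro μ n X hX k hδ hab
  ext c
  -- `pr_{1*}(pr_2^* c ∪ Δ_* 1) = pr_{1*} Δ_*(Δ^* pr_2^* c ∪ 1)` (projection formula, right to left)
  rw [corrAction_apply, ← complexGysin_cup μ.hasPoincareDuality hX
    (IsSmoothProjective.tensor_holds hX hX) (lift (𝟙 X) (𝟙 X)) (Nat.add_zero k)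
    (show k + 2 * (n + n) = (k + 2 * n) + 2 * n by ring) hδ rfl]
  -- `Δ^* pr_2^* c = c`, `c ∪ 1 = c`, `pr_{1*} Δ_* = Id`
  rw [← CategoryTheory.comp_apply, ← complexBetti.map_comp, lift_snd, complexBetti.map_id,
    CategoryTheory.id_apply, cupProduct_one, complexGysin_fst_complexGysin_diagonal,
    LinearMap.id_apply]

end Summit.HodgeConjecture.HodgeConjecture.Theorems

end
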